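import Literature.Geometry.Lorentzian.Hypersurface
import HarnessLib

/-!
# Uniqueness of the unit normal of a spacelike hypersurface

Topic `Literature/Geometry/Lorentzian`. Let `f : N → M` be a spacelike immersion of an `m`-manifold into an
`(m+1)`-dimensional Lorentzian manifold `(M, g)` (codimension one). At every point `y` the `g`-orthogonal
complement of `df(T_y N)` is a timelike LINE, so a unit normal of sign `−1` along `f` is unique up to sign
(`IsUnitNormal.apply_eq_or_eq_neg`), and the FUTURE unit normal with respect to a time orientation `τ` is unique
outright (`IsFutureUnitNormal.unique`: two future unit normal fields along `f` are equal). This is what one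
uses when two parametrised pieces of one spacelike hypersurface — each shipped with "a" future unit normal,
e.g. the existentially quantified `ν` of the Kerr-shielding block of the `FinalStateConjecture` routes, or the
normal of an exact Schwarzschild-cylinder piece — have to be shown to induce the same second fundamental form
on their overlap. O'Neill 1983, Ch. 5, Lemma 5.26 (the orthogonal complement of a timelike vector is
spacelike; equivalently a spacelike hyperplane of a Lorentz vector space has a timelike normal line) and
Ch. 4, pp. 106–107 (the unit normal of a semi-Riemannian hypersurface, unique up to sign); Wald 1984, §10.2
(the future-directed unit normal `n^a` of a spacelike slice).

* `eq_or_eq_neg_of_normal_of_unit` — the pointwise linear algebra: if `L : V' → V` is linear with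
  `g(Lv, Lv) > 0` for `v ≠ 0`, `dim V = dim V' + 1`, and `n₁, n₂` are `g`-orthogonal to `range L` with
  `g(nᵢ, nᵢ) = −1`, then `n₂ = n₁` or `n₂ = −n₁` (`range L ⊕ ℝ n₁ = V` by a dimension count; the
  `range L`-component of `n₂` is `g`-orthogonal to the positive definite `range L`, hence `0`);
* `eq_of_normal_of_unit_of_isFutureDirected` — with both `nᵢ` future-directed, `n₂ = n₁`;
* `IsUnitNormal.apply_eq_or_eq_neg`, `IsFutureUnitNormal.apply_eq`, `IsFutureUnitNormal.unique` — the
  statements along a spacelike immersion `f` (hypothesis `finrank E = finrank E' + 1` on the model spaces).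

Everything is proved; no definitions, no named facts.

## References

* B. O'Neill, *Semi-Riemannian geometry with applications to relativity* (1983), Ch. 4, pp. 106–107;
  Ch. 5, Lemma 5.26, p. 145. [folklore]
* R. M. Wald, *General Relativity* (1984), §10.2. [folklore]
-/

noncomputable section

open Bundle Set Manifold Module
open scoped ContDiff Topology

namespace Literature.Geometry.Lorentzian

variable {E : Type*} [NormedAddCommGroup E] [NormedSpace ℝ E] {H : Type*} [TopologicalSpace H]
  {I : ModelWithCorners ℝ E H} {M : Type*} [TopologicalSpace M] [ChartedSpace H M]
  {E' : Type*} [NormedAddCommGroup E'] [NormedSpace ℝ E'] {H' : Type*} [TopologicalSpace H']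
  {I' : ModelWithCorners ℝ E' H'} {N : Type*} [TopologicalSpace N] [ChartedSpace H' N]
  [IsManifold I ∞ M] {n : ℕ∞ω}

namespace LorentzianMetric

/-! ### Pointwise linear algebra -/

section Pointwise

variable [FiniteDimensional ℝ E] [FiniteDimensional ℝ E'] (g : LorentzianMetric I n M) {x : M}

/-- **The normal line of a spacelike hyperplane is timelike and one-dimensional (pointwise form).** Let
`L : E' →L E = T_x M` be (continuous) linear with `g_x(L v, L v) > 0` for `v ≠ 0` (so `L` is injective and `g_x` is
positive definite on `range L`) and `dim E = dim E' + 1`. If `n₁, n₂ ∈ T_x M` are both `g_x`-orthogonal to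
`range L` and both have `g_x(nᵢ, nᵢ) = −1`, then `n₂ = n₁` or `n₂ = −n₁`. Proof: `n₁ ∉ range L` (it has
negative square), so `range L ⊔ ℝ n₁` has dimension `dim E' + 1 = dim E` and is everything; write
`n₂ = L v₀ + c n₁`; pairing with `L v₀` gives `g(L v₀, L v₀) = 0`, so `v₀ = 0`; then `c² = 1`.
O'Neill 1983, Ch. 5, Lemma 5.26; Ch. 4, pp. 106–107. [folklore] -/
theorem eq_or_eq_neg_of_normal_of_unit (hdim : finrank ℝ E = finrank ℝ E' + 1)
    (L : E' →L[ℝ] TangentSpace I x) (hpos : ∀ v : E', v ≠ 0 → 0 < g.val x (L v) (L v))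
    {n₁ n₂ : TangentSpace I x} (h₁ : ∀ v : E', g.val x n₁ (L v) = 0) (h₂ : ∀ v : E', g.val x n₂ (L v) = 0)
    (hu₁ : g.val x n₁ n₁ = -1) (hu₂ : g.val x n₂ n₂ = -1) : n₂ = n₁ ∨ n₂ = -n₁ := by
  haveI : FiniteDimensional ℝ (TangentSpace I x) := inferInstanceAs (FiniteDimensional ℝ E)
  -- `L` is injective
  have hinj : Function.Injective (L : E' →ₗ[ℝ] TangentSpace I x) := by
    refine (injective_iff_map_eq_zero _).2 fun v hv ↦ ?_
    by_contra hne
    have := hpos v hne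
    rw [ContinuousLinearMap.coe_coe] at hv
    rw [hv] at this
    simp at this
  -- `n₁ ∉ range L`
  have hn₁ : n₁ ∉ LinearMap.range (L : E' →ₗ[ℝ] TangentSpace I x) := by
    rintro ⟨v, hv⟩
    rw [ContinuousLinearMap.coe_coe] at hv
    by_cases hv0 : v = 0
    · subst hv0
      rw [map_zero] at hv
      rw [← hv] at hu₁
      simp at hu₁
    · have := hpos v hv0
      rw [hv] at this
      linarith
  have hn₁0 : n₁ ≠ 0 := by
    rintro rfl
    simp at hu₁
  -- dimension count: `range L ⊔ span {n₁} = ⊤`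
  set W : Submodule ℝ (TangentSpace I x) := LinearMap.range (L : E' →ₗ[ℝ] TangentSpace I x) with hW
  set S : Submodule ℝ (TangentSpace I x) := ℝ ∙ n₁ with hS
  have hWdim : finrank ℝ W = finrank ℝ E' := LinearMap.finrank_range_of_inj hinj
  have hSdim : finrank ℝ S = 1 := finrank_span_singleton hn₁0
  have hdisj : W ⊓ S = ⊥ := by
    rw [← disjoint_iff, Submodule.disjoint_span_singleton' hn₁0]
    exact hn₁
  have htop : W ⊔ S = ⊤ := by
    apply Submodule.eq_top_of_finrank_eq
    have h := Submodule.finrank_sup_add_finrank_inf_eq W S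
    rw [hdisj, finrank_bot, add_zero, hWdim, hSdim] at h
    have hE : finrank ℝ (TangentSpace I x) = finrank ℝ E := rfl
    rw [h, hE, hdim]
  -- decompose `n₂`
  have hmem : n₂ ∈ W ⊔ S := by rw [htop]; exact Submodule.mem_top
  obtain ⟨w, hw, s, hs, hws⟩ := Submodule.mem_sup.1 hmem
  obtain ⟨v₀, rfl⟩ := LinearMap.mem_range.1 hw
  obtain ⟨c, rfl⟩ := Submodule.mem_span_singleton.1 hs
  rw [ContinuousLinearMap.coe_coe] at hws
  -- the `range L` component vanishes
  have hv₀ : v₀ = 0 := by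
    by_contra hv₀
    have hp := hpos v₀ hv₀
    have hz : g.val x (L v₀) (L v₀) = 0 := by
      have e := h₂ v₀
      rw [← hws] at e
      simpa [h₁ v₀] using e
    linarith
  subst hv₀
  rw [map_zero, zero_add] at hws
  -- `c² = 1`
  have hc : c ^ 2 = 1 := by
    rw [← hws] at hu₂
    simp only [map_smul, smul_eq_mul] at hu₂
    simp [hu₁] at hu₂
    nlinarith
  have hc' : c = 1 ∨ c = -1 := by
    have : (c - 1) * (c + 1) = 0 := by nlinarith
    rcases mul_eq_zero.1 this with h | h
    · exact Or.inl (by linarith)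
    · exact Or.inr (by linarith)
  rcases hc' with rfl | rfl
  · left; rw [← hws, one_smul]
  · right; rw [← hws, neg_one_smul]

/-- **The future unit normal of a spacelike hyperplane is unique (pointwise form)**: in the situation of
`eq_or_eq_neg_of_normal_of_unit`, if moreover `n₁` and `n₂` are both future-directed for a time orientation
`τ`, then `n₂ = n₁` (`−n₁` is past-directed). O'Neill 1983, Ch. 5, p. 145; Wald 1984, §10.2. [folklore] -/
theorem eq_of_normal_of_unit_of_isFutureDirected (τ : TimeOrientation g) (hdim : finrank ℝ E = finrank ℝ E' + 1)
    (L : E' →L[ℝ] TangentSpace I x) (hpos : ∀ v : E', v ≠ 0 → 0 < g.val x (L v) (L v))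
    {n₁ n₂ : TangentSpace I x} (h₁ : ∀ v : E', g.val x n₁ (L v) = 0) (h₂ : ∀ v : E', g.val x n₂ (L v) = 0)
    (hu₁ : g.val x n₁ n₁ = -1) (hu₂ : g.val x n₂ n₂ = -1) (hf₁ : τ.IsFutureDirected n₁)
    (hf₂ : τ.IsFutureDirected n₂) : n₂ = n₁ := by
  rcases g.eq_or_eq_neg_of_normal_of_unit hdim L hpos h₁ h₂ hu₁ hu₂ with h | h
  · exact h
  · exfalso
    rw [h, TimeOrientation.isFutureDirected_neg_iff] at hf₂
    exact τ.not_isPastDirected_of_isFutureDirected hf₁ hf₂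

end Pointwise

/-! ### Along a spacelike immersion -/

section Immersion

variable [FiniteDimensional ℝ E] [FiniteDimensional ℝ E'] {g : LorentzianMetric I n M} {f : N → M}

/-- **A unit normal of sign `−1` along a codimension-one spacelike immersion is unique up to sign,
pointwise**: if `f : N → M` is a spacelike immersion, `dim E = dim E' + 1`, and `ν₁, ν₂` are unit normals of
sign `−1` along `f`, then `ν₂ y = ν₁ y` or `ν₂ y = −ν₁ y` at every `y`. O'Neill 1983, Ch. 4, pp. 106–107;
Ch. 5, Lemma 5.26. [folklore] -/
theorem _root_.Literature.Geometry.Lorentzian.PseudoRiemannianMetric.IsUnitNormal.apply_eq_or_eq_neg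
    (hdim : finrank ℝ E = finrank ℝ E' + 1) (hf : g.IsSpacelikeImmersion I' f)
    {ν₁ ν₂ : NormalField I f} (h₁ : g.IsUnitNormal I' f ν₁ (-1)) (h₂ : g.IsUnitNormal I' f ν₂ (-1)) (y : N) :
    ν₂ y = ν₁ y ∨ ν₂ y = -ν₁ y :=
  g.eq_or_eq_neg_of_normal_of_unit (x := f y) hdim (mfderiv I' I f y)
    (fun v hv ↦ by
      have h := hf.inducedBilin_pos y hv
      rw [PseudoRiemannianMetric.inducedBilin_apply] at h
      exact h)
    (fun v ↦ h₁.1 y v) (fun v ↦ h₂.1 y v) (h₁.2 y) (h₂.2 y)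

/-- **The future unit normal along a codimension-one spacelike immersion is unique, pointwise.**
O'Neill 1983, Ch. 5, p. 145; Wald 1984, §10.2. [folklore] -/
theorem IsFutureUnitNormal.apply_eq {τ : TimeOrientation g} (hdim : finrank ℝ E = finrank ℝ E' + 1)
    (hf : g.IsSpacelikeImmersion I' f) {ν₁ ν₂ : NormalField I f} (h₁ : g.IsFutureUnitNormal I' τ f ν₁)
    (h₂ : g.IsFutureUnitNormal I' τ f ν₂) (y : N) : ν₂ y = ν₁ y :=
  g.eq_of_normal_of_unit_of_isFutureDirected (x := f y) τ hdim (mfderiv I' I f y)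
    (fun v hv ↦ by
      have h := hf.inducedBilin_pos y hv
      rw [PseudoRiemannianMetric.inducedBilin_apply] at h
      exact h)
    (fun v ↦ h₁.1.1 y v) (fun v ↦ h₂.1.1 y v) (h₁.1.2 y) (h₂.1.2 y) (h₁.2 y) (h₂.2 y)

/-- **Uniqueness of the future unit normal field** of a codimension-one spacelike immersion into a
time-oriented Lorentzian manifold: two future unit normal fields along `f` coincide. O'Neill 1983, Ch. 5,
p. 145; Wald 1984, §10.2 ("the" unit normal `n^a`). [folklore] -/
theorem IsFutureUnitNormal.unique {τ : TimeOrientation g} (hdim : finrank ℝ E = finrank ℝ E' + 1)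
    (hf : g.IsSpacelikeImmersion I' f) {ν₁ ν₂ : NormalField I f} (h₁ : g.IsFutureUnitNormal I' τ f ν₁)
    (h₂ : g.IsFutureUnitNormal I' τ f ν₂) : ν₂ = ν₁ :=
  funext fun y ↦ h₁.apply_eq hdim hf h₂ y |>.symm ▸ rfl

/-- The oriented uniqueness read on values in the model fibre: at every point the two future unit normals
have the same value (convenient when the normals are given by representatives `N₁ N₂ : N → E`).
[folklore] -/
theorem IsFutureUnitNormal.apply_eq_of_eq {τ : TimeOrientation g} (hdim : finrank ℝ E = finrank ℝ E' + 1)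
    (hf : g.IsSpacelikeImmersion I' f) {ν₁ ν₂ : NormalField I f} (h₁ : g.IsFutureUnitNormal I' τ f ν₁)
    (h₂ : g.IsFutureUnitNormal I' τ f ν₂) {N₁ N₂ : N → E} (hN₁ : ∀ y, ν₁ y = N₁ y) (hN₂ : ∀ y, ν₂ y = N₂ y)
    (y : N) : N₂ y = N₁ y := by
  rw [← hN₁, ← hN₂]
  exact h₁.apply_eq hdim hf h₂ y

end Immersion

end LorentzianMetric

end Literature.Geometry.Lorentzian

end
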